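import Mathlib
import HarnessLib
import Summits.HubbardSuperconductivity.HubbardSuperconductivity.Theorems.KLProgrammeKLRegimeVolumeLimitV12EndDoorsWA
import Summits.HubbardSuperconductivity.HubbardSuperconductivity.Theorems.KLProgrammeKLRegimeTwoVolumeGluedPairPos
import Summits.HubbardSuperconductivity.HubbardSuperconductivity.Theorems.KLProgrammeKLRegimeTwoVolumeSourceWindowedPairKernel
import Summits.HubbardSuperconductivity.HubbardSuperconductivity.Theorems.KLProgrammeKLRegimeTwoVolumeSourceWindowedWeightedRows
import Summits.HubbardSuperconductivity.HubbardSuperconductivity.Theorems.KLProgrammeKLRegimeVolumeLimitV10GluedSrcPairDoorAt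

/-!
# K3 VL child (stmt-HubbardSuperconductivity-20440), window key «(VL)-SRC-WINDOW» (pen (R235) KEY = WINDOW), binder `R.WF2`:
# THE END DOORS FOR WINDOW-DRESSED SOURCE LEGS — part B: the glued position-space door (g)W and THE TOP
# `stub_vl_nestedFramed_of_gluedWindowDefect_keyedAt_lev_wf2` = the text of `stub_vl_windowedEndDoor` of the v12W image (prestage sw/doorW_type.txt)
# (cell gate-hubbard-kl, seat hubbard-kl-k3c4-p1 g17; inputs BY NAME: part A (p652840), k3c4 g17's generic `twoEps_near_le_gluedPos_add_far` (p653276),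
# p1 g22's (N1) `kernel_srcTrunc_map_smul_klSrcAnalysisAtW_pair` (p652398) and (N2) `exists_windowedWeightedRows_le` (p652697), k3c5-p3's `keyedReduced_eq_ite`,
# `two_mul_eps_eq`, `tendsto_farRate_of_depth`, `klSrcPinnedSum_two_two_le_of_sourceProfilesAtLev`)

Currency: `W^χ_V := sectorisedKernel V M β (srcWindowFamily V M) (𝒱_V[K_V]) 2 ((0,0,+),(0,0,−))`, `K_V = klFlowFrameU V M β U μ (n_β+1)`, scale `n⋆ = n_β+1`.
* (g)W `framedNestedFlowTextV17F2_of_windowGluedPosDefect_weightedRows_wf2` — the stub text from: `∃ L₀ δ→0 B`, `∃ Rd → ∞`, for `L ≥ L₀`, `L″ = b·L`, eventually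
  in `M`, an `(Rd L)`-deep fine pin `o_f` with (GLUED, position space) `2ε·Σ_{t₁,y}‖W^χ_{L″}(o_f,(t₁,y)) − [y ∼ o⃗_f]·W^χ_L((t_f, red o⃗_f),(t₁,red y))‖ ≤ δ L` and the
  `ε`-weighted rows of BOTH volumes at the pin `≤ B`; proof = door (f)W after `twoEps_near_le_gluedPos_add_far` (near ≤ glued + `2(B+B)/(1+Λ_{n⋆}·Rd L)`,
  `tendsto_farRate_of_depth`).
* TOP `stub_vl_nestedFramed_of_gluedWindowDefect_keyedAt_lev_wf2` — EXACTLY the (β) text: from the KEYED block-reduced defect of the pair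
  `srcTrunc 3 (map (toLin' (ε • klSrcAnalysisAtW V M β μ K_V J)) 𝒱_V[K_V])` (any alive index `J`, some doubled block structure `(e, ed)`) summed over the
  source-pair strings at an `(Rd L)`-deep source pin, normalised `2ε⁻¹·(·) ≤ δ L`, PLUS the producer's `SourceProfilesAtLev` (token #24, read at `(P, R₁)`), to the
  registered text of `stub_vl_nestedFramed` (binder `R.WF2`).  Proof = (g)W after: `keyedReduced_eq_ite` (keyed ↦ e-free block test), restriction of the string sum
  to the slot-`0`, spin-`↑`, `(+,−)` source pairs `(t₁, y) ↦ ((o_f,+),((t₁,y),−))` (an injection; nonnegative terms), (N1) on both volumes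
  (`kernel = ε²·W^χ`, so `2ε·GLUED_pos = 2ε⁻¹·(ε²·GLUED_pos) ≤ 2ε⁻¹·KEYED`, `two_mul_eps_eq`), and (N2) at every pin time with token #24's
  `klSrcPinnedSum ≤ A (n⋆) 2` (`klSrcPinnedSum_two_two_le_of_sourceProfilesAtLev`), `B := C·A (n⋆) 2` with the (N2) constant `C` obtained once.

Honest framing: door composition; nothing asserts the keyed hypothesis, the producer text, any stub, K3, VL or superconductivity.
[cite: BenfattoGiulianiMastropietro2006, §2.4 (2.38), §2.9 (4.3)-(4.6)]
-/

noncomputable section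

open Finset Filter Topology Complex Literature.MathematicalPhysics.QuantumLattice Literature.Probability.LatticeModels GrassmannAlgebra
open Summit.HubbardSuperconductivity.HubbardSuperconductivity.Theorems.EngineV8
open Summit.HubbardSuperconductivity.HubbardSuperconductivity.Theorems.KLProgrammeLegKernels
open Summit.HubbardSuperconductivity.HubbardSuperconductivity.Theorems.KLRegimeSplit
open Summit.HubbardSuperconductivity.HubbardSuperconductivity.Theorems.TwoPointAssembly
open Summit.HubbardSuperconductivity.HubbardSuperconductivity.Theorems.TwoVolumeDefect
open Summit.HubbardSuperconductivity.HubbardSuperconductivity.Theorems.TwoVolumeSource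

set_option linter.dupNamespace false -- summit = problem name (single-conjunct summit), D-0017

namespace Summit.HubbardSuperconductivity.HubbardSuperconductivity.Theorems.TwoVolumeDefect

/-- **DOOR (g)W — OWN FRAMES: GLUED POSITION-SPACE DEFECT OF THE WINDOW-DRESSED KERNELS AT A DEEP PIN + WEIGHTED ROWS OF BOTH VOLUMES.**  The registered
text of `stub_vl_nestedFramed` (binder `R.WF2`) from: `∃ L₀ δ→0 B`, `∃ Rd → ∞`, for `L ≥ L₀`, `L″ = b·L`, eventually in `M`, an `(Rd L)`-deep fine pin `o_f` with
`2ε·Σ_{t₁,y}‖W^χ_{L″}(o_f,(t₁,y)) − [y ∼ o⃗_f]·W^χ_L((t_f,red o⃗_f),(t₁,red y))‖ ≤ δ L` (`y ∼ o⃗_f`: same blocks, `y_j / L = (o⃗_f)_j / L`) and the `ε`-weighted rows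
`ε·Σ(1 + Λ_{n⋆}‖·‖_𝕋)‖W^χ_V(pin, ·)‖ ≤ B` for `V = L″` (pin `o_f`) and `V = L` (pin `(t_f, red o⃗_f)`).  Door (f)W after `twoEps_near_le_gluedPos_add_far`.
[cite: BenfattoGiulianiMastropietro2006, §2.4 (2.38), §2.9 (4.3)-(4.6)] -/
theorem framedNestedFlowTextV17F2_of_windowGluedPosDefect_weightedRows_wf2
    (hD : ∀ (G : GeoConsts) (P : SplitConsts) (Q : EngConsts) (R : RenConsts), G.WF → P.WF → Q.WF → R.WF2 →
      ∃ c₅ : ℝ, 0 < c₅ ∧ ∀ c : ℝ, 0 < c → c ≤ c₅ → ∃ U₀ : ℝ, 0 < U₀ ∧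
        ∀ μ ∈ klWindowC, ∀ U : ℝ, 0 < U → U ≤ U₀ → ∀ β : ℝ, klBetaMin ≤ β → β ≤ Real.exp (c / U ^ 2) →
          ∀ K : TrigPolyC4v, klPredsV17F2.frameOK R U (nScales β) μ K →
            ∀ (Lstar : ℕ) (Mstar : ℕ → ℕ), TowerP klPredsV17F2 G P Q R β U μ K Lstar Mstar →
              ∃ L₀ : ℕ, ∃ δ : ℕ → ℝ, ∃ B : ℝ, Tendsto δ atTop (𝓝 0) ∧ ∃ Rd : ℕ → ℕ, Tendsto Rd atTop atTop ∧
                ∀ (L : ℕ) [NeZero L], L₀ ≤ L → ∀ (L'' : ℕ) [NeZero L''] (b : ℕ), L'' = b * L → ∃ M₀ : ℕ, ∀ (M : ℕ) [NeZero M], M₀ ≤ M →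
                  ∃ of : SpaceTimeIdx L'' M, (∀ j, Rd L ≤ (of.2 j).val % L ∧ (of.2 j).val % L + Rd L < L) ∧
                    2 * imagTimeWeight β M *
                      (∑ t₁ : ImagTimeIdx M, ∑ y : TorusSite 2 L'',
                          ‖sectorisedKernel L'' M β (srcWindowFamily L'' M)
                                (klEffectiveAction L'' M β U μ (klFlowFrameU L'' M β U μ (nScales β + 1)) klE0 (nScales β + 1)) 2
                                (![((0, 0), 0), ((0, 0), 1)] : Fin 2 → SectorLeg 1) ![of, (t₁, y)] -
                            (if ∀ j, (y j).val / L = (of.2 j).val / L then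
                              sectorisedKernel L M β (srcWindowFamily L M)
                                (klEffectiveAction L M β U μ (klFlowFrameU L M β U μ (nScales β + 1)) klE0 (nScales β + 1)) 2
                                (![((0, 0), 0), ((0, 0), 1)] : Fin 2 → SectorLeg 1)
                                ![(of.1, fun i => (((of.2 i).val : ℕ) : ZMod L)), (t₁, fun i => (((y i).val : ℕ) : ZMod L))]
                            else 0)‖) ≤ δ L ∧
                    imagTimeWeight β M *
                      ∑ t₁ : ImagTimeIdx M, ∑ y : TorusSite 2 L'',
                        (1 + klScale klE0 (nScales β + 1) * (Torus.tnorm y : ℝ)) *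
                          ‖sectorisedKernel L'' M β (srcWindowFamily L'' M)
                              (klEffectiveAction L'' M β U μ (klFlowFrameU L'' M β U μ (nScales β + 1)) klE0 (nScales β + 1)) 2
                              (![((0, 0), 0), ((0, 0), 1)] : Fin 2 → SectorLeg 1) ![of, (t₁, of.2 + y)]‖ ≤ B ∧
                    imagTimeWeight β M *
                      ∑ t₁ : ImagTimeIdx M, ∑ ybar : TorusSite 2 L,
                        (1 + klScale klE0 (nScales β + 1) * (Torus.tnorm ybar : ℝ)) *
                          ‖sectorisedKernel L M β (srcWindowFamily L M)
                              (klEffectiveAction L M β U μ (klFlowFrameU L M β U μ (nScales β + 1)) klE0 (nScales β + 1)) 2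
                              (![((0, 0), 0), ((0, 0), 1)] : Fin 2 → SectorLeg 1)
                              ![(of.1, fun i => (((of.2 i).val : ℕ) : ZMod L)), (t₁, (fun i => (((of.2 i).val : ℕ) : ZMod L)) + ybar)]‖ ≤ B) :
    ∀ (G : GeoConsts) (P : SplitConsts) (Q : EngConsts) (R : RenConsts), G.WF → P.WF → Q.WF → R.WF2 →
      ∃ c₅ : ℝ, 0 < c₅ ∧ ∀ c : ℝ, 0 < c → c ≤ c₅ → ∃ U₀ : ℝ, 0 < U₀ ∧
        ∀ μ ∈ klWindowC, ∀ U : ℝ, 0 < U → U ≤ U₀ → ∀ β : ℝ, klBetaMin ≤ β → β ≤ Real.exp (c / U ^ 2) →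
          ∀ K : TrigPolyC4v, klPredsV17F2.frameOK R U (nScales β) μ K →
            ∀ (Lstar : ℕ) (Mstar : ℕ → ℕ), TowerP klPredsV17F2 G P Q R β U μ K Lstar Mstar →
              ∀ n : ℤ, ∃ L₀ : ℕ, ∃ ρ : ℕ → ℝ, Tendsto ρ atTop (𝓝 0) ∧
                ∀ (L : ℕ) [NeZero L], L₀ ≤ L → ∀ (L'' : ℕ) [NeZero L''], L ∣ L'' → ∃ M₀ : ℕ, ∀ (M : ℕ) [NeZero M], M₀ ≤ M →
                  ∀ (ω : MatsubaraIdx M), matsubaraInt M ω = n → ∀ (k : TorusSite 2 L) (k'' : TorusSite 2 L''),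
                    latticeMomentum L'' k'' = latticeMomentum L k →
                      ‖klSelfEnergy L M β U μ (klFlowFrameU L M β U μ (nScales β + 1)) klE0 (nScales β + 1) (ω, k) 0 -
                          klSelfEnergy L'' M β U μ (klFlowFrameU L'' M β U μ (nScales β + 1)) klE0 (nScales β + 1) (ω, k'') 0‖ ≤ ρ L := by
  refine framedNestedFlowTextV17F2_of_windowNearDefect_weightedRows_wf2 fun G P Q R hG hP hQ hR => ?_
  obtain ⟨c₅, hc₅, hc⟩ := hD G P Q R hG hP hQ hR
  refine ⟨c₅, hc₅, fun c hc0 hcc => ?_⟩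
  obtain ⟨U₀, hU₀, hU⟩ := hc c hc0 hcc
  refine ⟨U₀, hU₀, fun μ hμ U hU0 hUU β hβmin hβmax K hK Lstar Mstar hT => ?_⟩
  have hβ : 0 < β := KLRegimeSplit.pos_of_klBetaMin_le hβmin
  have hΛ : 0 < klScale klE0 (nScales β + 1) := klth_klScale_pos _
  obtain ⟨L₀, δ, B, hδ, Rd, hRd, hDn⟩ := hU μ hμ U hU0 hUU β hβmin hβmax K hK Lstar Mstar hT
  refine ⟨L₀, fun L => δ L + 2 * (B + B) / (1 + klScale klE0 (nScales β + 1) * (Rd L : ℝ)), B, ?_, fun L _ hL L'' _ b hb => ?_⟩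
  · simpa using hδ.add (tendsto_farRate_of_depth hΛ (B + B) hRd)
  obtain ⟨M₀, hM₀⟩ := hDn L hL L'' b hb
  refine ⟨M₀, fun M _ hM => ?_⟩
  obtain ⟨of, hof, hglued, hBf, hBc⟩ := hM₀ M hM
  have hε : 0 ≤ imagTimeWeight β M := imagTimeWeight_nonneg hβ.le M
  refine ⟨(of.1, fun i => (((of.2 i).val : ℕ) : ZMod L)), of, rfl, ?_, hBf⟩
  have h := twoEps_near_le_gluedPos_add_far hb
    (sectorisedKernel L M β (srcWindowFamily L M) (klEffectiveAction L M β U μ (klFlowFrameU L M β U μ (nScales β + 1)) klE0 (nScales β + 1)) 2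
      (![((0, 0), 0), ((0, 0), 1)] : Fin 2 → SectorLeg 1))
    (sectorisedKernel L'' M β (srcWindowFamily L'' M) (klEffectiveAction L'' M β U μ (klFlowFrameU L'' M β U μ (nScales β + 1)) klE0 (nScales β + 1)) 2
      (![((0, 0), 0), ((0, 0), 1)] : Fin 2 → SectorLeg 1))
    of hof hε hΛ.le hBc hBf
  exact h.trans (add_le_add hglued le_rfl)

end Summit.HubbardSuperconductivity.HubbardSuperconductivity.Theorems.TwoVolumeDefect

namespace Summit.HubbardSuperconductivity.HubbardSuperconductivity.Theorems.TwoPointAssembly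

/-- **THE TOP OF THE WINDOW-KEYED END CHAIN — the text of `stub_vl_windowedEndDoor` (v12W image)**: the KEYED block-reduced defect of the pair
`X_V = srcTrunc 3 (map (toLin' (ε • klSrcAnalysisAtW V M β μ K_V J)) 𝒱_{n⋆}[K_V])` (`V = L″, L`; any alive index `J`; `ε = imagTimeWeight β M`) summed over the
SOURCE-PAIR strings at an `(Rd L)`-deep source pin, normalised as the spine tracks it (`2ε⁻¹·KEYED ≤ δ L`), together with the producer's sub-diagonal
`SourceProfilesAtLev` read-out (token #24), closes the registered `stub_vl_nestedFramed` with binder `R.WF2`.  Door (g)W after the keyed ↦ e-free reduction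
(`keyedReduced_eq_ite`), the restriction to slot-`0` spin-`↑` `(+,−)` source pairs, (N1) `kernel_srcTrunc_map_smul_klSrcAnalysisAtW_pair` on both volumes and
(N2) `exists_windowedWeightedRows_le` at every pin time. [cite: BenfattoGiulianiMastropietro2006, §2.9 (4.3)-(4.6)] -/
theorem stub_vl_nestedFramed_of_gluedWindowDefect_keyedAt_lev_wf2
    (hGlued : ∀ (G : GeoConsts) (P : SplitConsts) (Q : EngConsts) (R : RenConsts), G.WF → P.WF → Q.WF → R.WF2 →
      ∃ c₅ : ℝ, 0 < c₅ ∧ ∀ c : ℝ, 0 < c → c ≤ c₅ → ∃ U₀ : ℝ, 0 < U₀ ∧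
        ∀ μ ∈ klWindowC, ∀ U : ℝ, 0 < U → U ≤ U₀ → ∀ β : ℝ, klBetaMin ≤ β → β ≤ Real.exp (c / U ^ 2) →
          ∀ K : TrigPolyC4v, klPredsV17F2.frameOK R U (nScales β) μ K →
            ∀ (Lstar : ℕ) (Mstar : ℕ → ℕ), TowerP klPredsV17F2 G P Q R β U μ K Lstar Mstar →
              ∃ L₀ : ℕ, ∃ δ : ℕ → ℝ, Tendsto δ atTop (𝓝 0) ∧ ∃ Rd : ℕ → ℕ, Tendsto Rd atTop atTop ∧
                ∀ (L : ℕ) [NeZero L], L₀ ≤ L → ∀ (L'' : ℕ) [NeZero L''] (b : ℕ), L'' = b * L → ∃ M₀ : ℕ, ∀ (M : ℕ) [NeZero M], M₀ ≤ M →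
                  ∃ (J : ℕ) (e : (SpaceTimeIdx L'' M × SectorLeg (sectorCount J)) ≃ (Fin 2 → Fin b) × (SpaceTimeIdx L M × SectorLeg (sectorCount J)))
                    (ed : SrcLabel L'' M J ≃ (Fin 2 → Fin b) × SrcLabel L M J),
                    (∀ X' i, ((e X').1 i : ℕ) = (X'.1.2 i).val / L) ∧
                    (∀ X', (e X').2 = ((X'.1.1, fun i => (((X'.1.2 i).val : ℕ) : ZMod L)), X'.2)) ∧
                    (∀ x s, ed (x, s) = ((e x).1, ((e x).2, s))) ∧
                  ∃ of : SpaceTimeIdx L'' M, (∀ j, Rd L ≤ (of.2 j).val % L ∧ (of.2 j).val % L + Rd L < L) ∧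
                    2 * (imagTimeWeight β M)⁻¹ *
                      (∑ X ∈ univ.filter (fun X : Fin 2 → SrcLabel L'' M J => X 0 = ((of, ((⟨0, sectorCount_pos _⟩, 0), 0)), 1) ∧ (X 1).2 = 1),
                        ‖kernel ℂ (srcTrunc ℂ (fun Y : SrcLabel L'' M J => Y.2 = 1) 3
                              (ExteriorAlgebra.map (Matrix.toLin' (((imagTimeWeight β M : ℝ) : ℂ) •
                                  klSrcAnalysisAtW L'' M β μ (klFlowFrameU L'' M β U μ (nScales β + 1)) J))
                                (klEffectiveAction L'' M β U μ (klFlowFrameU L'' M β U μ (nScales β + 1)) klE0 (nScales β + 1)))) 2 X -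
                            (if ∀ i, (ed (X i)).1 = (ed (X 0)).1 then
                              kernel ℂ (srcTrunc ℂ (fun Y : SrcLabel L M J => Y.2 = 1) 3
                                (ExteriorAlgebra.map (Matrix.toLin' (((imagTimeWeight β M : ℝ) : ℂ) •
                                    klSrcAnalysisAtW L M β μ (klFlowFrameU L M β U μ (nScales β + 1)) J))
                                  (klEffectiveAction L M β U μ (klFlowFrameU L M β U μ (nScales β + 1)) klE0 (nScales β + 1)))) 2
                                (fun i => (ed (X i)).2)
                            else 0)‖) ≤ δ L) :
    (∀ (P : SplitConsts) (R : RenConsts), P.WF → R.WF2 →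
      ∃ Q' : EngConsts, 0 ≤ Q'.CE ∧ ∃ c₀ : ℝ, 0 < c₀ ∧ ∀ c : ℝ, 0 < c → c ≤ c₀ → ∃ U₀ : ℝ, 0 < U₀ ∧
        ∀ μ ∈ klWindowC, ∀ U : ℝ, 0 < U → U ≤ U₀ → ∀ β : ℝ, klBetaMin ≤ β → β ≤ Real.exp (c / U ^ 2) →
          ∃ A : ℕ → ℕ → ℝ, ∃ L₁ : ℕ, ∃ M₁ : ℕ → ℕ, ∀ (L M : ℕ) [NeZero L] [NeZero M], L₁ ≤ L → M₁ L ≤ M →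
            ∀ j : ℕ, j + 1 ≤ nScales β + 1 →
              SourceProfilesAtLev L M (klSrcBudget P Q' U A (j + 1)) β U μ (klFlowFrameU L M β U μ (nScales β + 1)) j j (j + 1)) →
    ∀ (G : GeoConsts) (P : SplitConsts) (Q : EngConsts) (R : RenConsts), G.WF → P.WF → Q.WF → R.WF2 →
      ∃ c₅ : ℝ, 0 < c₅ ∧ ∀ c : ℝ, 0 < c → c ≤ c₅ → ∃ U₀ : ℝ, 0 < U₀ ∧
        ∀ μ ∈ klWindowC, ∀ U : ℝ, 0 < U → U ≤ U₀ → ∀ β : ℝ, klBetaMin ≤ β → β ≤ Real.exp (c / U ^ 2) →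
          ∀ K : TrigPolyC4v, klPredsV17F2.frameOK R U (nScales β) μ K →
            ∀ (Lstar : ℕ) (Mstar : ℕ → ℕ), TowerP klPredsV17F2 G P Q R β U μ K Lstar Mstar →
              ∀ n : ℤ, ∃ L₀ : ℕ, ∃ ρ : ℕ → ℝ, Tendsto ρ atTop (𝓝 0) ∧
                ∀ (L : ℕ) [NeZero L], L₀ ≤ L → ∀ (L'' : ℕ) [NeZero L''], L ∣ L'' → ∃ M₀ : ℕ, ∀ (M : ℕ) [NeZero M], M₀ ≤ M →
                  ∀ (ω : MatsubaraIdx M), matsubaraInt M ω = n → ∀ (k : TorusSite 2 L) (k'' : TorusSite 2 L''),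
                    latticeMomentum L'' k'' = latticeMomentum L k →
                      ‖klSelfEnergy L M β U μ (klFlowFrameU L M β U μ (nScales β + 1)) klE0 (nScales β + 1) (ω, k) 0 -
                          klSelfEnergy L'' M β U μ (klFlowFrameU L'' M β U μ (nScales β + 1)) klE0 (nScales β + 1) (ω, k'') 0‖ ≤ ρ L := by
  intro hSrc
  classical
  -- the (N2) constant, once
  obtain ⟨C, -, hC⟩ := exists_windowedWeightedRows_le
  -- token #24 at `(P, R₁)`, `R₁ = ⟨1, 1, 1⟩` well-formed; thresholds shared by `min` / `max`
  have hR₁ : (⟨1, 1, fun _ => 1⟩ : RenConsts).WF2 := ⟨⟨zero_le_one, zero_le_one, fun _ => zero_le_one⟩, one_pos, one_pos⟩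
  refine framedNestedFlowTextV17F2_of_windowGluedPosDefect_weightedRows_wf2 ?_
  intro G P Q R hG hP hQ hR
  obtain ⟨Q'', -, c₀', hc₀', hS'⟩ := hSrc P ⟨1, 1, fun _ => 1⟩ hP hR₁
  obtain ⟨c₅, hc₅, hN⟩ := hGlued G P Q R hG hP hQ hR
  refine ⟨min c₅ c₀', lt_min hc₅ hc₀', fun c hc0 hcc => ?_⟩
  obtain ⟨U₁, hU₁, hN1⟩ := hN c hc0 (hcc.trans (min_le_left _ _))
  obtain ⟨U₂, hU₂, hS2⟩ := hS' c hc0 (hcc.trans (min_le_right _ _))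
  refine ⟨min U₁ U₂, lt_min hU₁ hU₂, fun μ hμ U hU0 hUU β hβmin hβmax K hK Lstar Mstar hT => ?_⟩
  have hβ : 0 < β := KLRegimeSplit.pos_of_klBetaMin_le hβmin
  obtain ⟨L₀, δ, hδ, Rd, hRd, hLn⟩ := hN1 μ hμ U hU0 (hUU.trans (min_le_left _ _)) β hβmin hβmax K hK Lstar Mstar hT
  obtain ⟨A, L₁, M₁, hA⟩ := hS2 μ hμ U hU0 (hUU.trans (min_le_right _ _)) β hβmin hβmax
  refine ⟨max L₀ L₁, δ, C * A (nScales β + 1) 2, hδ, Rd, hRd, fun L _ hL L'' _ b hb => ?_⟩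
  obtain ⟨M₀, hM₀⟩ := hLn L ((le_max_left _ _).trans hL) L'' b hb
  have hLL'' : L ≤ L'' := Nat.le_of_dvd (Nat.pos_of_ne_zero (NeZero.ne L'')) ⟨b, by rw [hb, mul_comm]⟩
  have hL₁ : L₁ ≤ L := (le_max_right _ _).trans hL
  have hL₁'' : L₁ ≤ L'' := hL₁.trans hLL''
  refine ⟨max M₀ (max (M₁ L) (M₁ L'')), fun M _ hM => ?_⟩
  obtain ⟨J, e, ed, he1, he2, hed, of, hof, hglued⟩ := hM₀ M ((le_max_left _ _).trans hM)
  have hML : M₁ L ≤ M := (le_max_left _ _).trans ((le_max_right _ _).trans hM)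
  have hML'' : M₁ L'' ≤ M := (le_max_right _ _).trans ((le_max_right _ _).trans hM)
  -- token #24 at every slot-`0` source pin of both volumes
  have hAf : ∀ o : SpaceTimeIdx L'' M, klSrcPinnedSum L'' M β U μ (klFlowFrameU L'' M β U μ (nScales β + 1)) (nScales β + 1) 2 2 0
      ((o, ((⟨0, sectorCount_pos _⟩, 0), 0)), 1) ≤ A (nScales β + 1) 2 := fun o =>
    klSrcPinnedSum_two_two_le_of_sourceProfilesAtLev hβ.le (Nat.le_succ _) (hA L'' M hL₁'' hML'' (nScales β) le_rfl) o 0 0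
  have hAc : ∀ o : SpaceTimeIdx L M, klSrcPinnedSum L M β U μ (klFlowFrameU L M β U μ (nScales β + 1)) (nScales β + 1) 2 2 0
      ((o, ((⟨0, sectorCount_pos _⟩, 0), 0)), 1) ≤ A (nScales β + 1) 2 := fun o =>
    klSrcPinnedSum_two_two_le_of_sourceProfilesAtLev hβ.le (Nat.le_succ _) (hA L M hL₁ hML (nScales β) le_rfl) o 0 0
  refine ⟨of, hof, ?_, hC L'' M β hβ U μ _ (nScales β + 1) of _ (fun τ => hAf (τ, of.2)),
    hC L M β hβ U μ _ (nScales β + 1) (of.1, fun i => (((of.2 i).val : ℕ) : ZMod L)) _ (fun τ => hAc (τ, _))⟩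
  -- the glued position-space defect is (a sub-sum of) the keyed defect: names
  set ε : ℝ := imagTimeWeight β M with hε_def
  set Kc := klFlowFrameU L M β U μ (nScales β + 1) with hKc
  set Kf := klFlowFrameU L'' M β U μ (nScales β + 1) with hKf
  set Af := srcTrunc ℂ (fun Y : SrcLabel L'' M J => Y.2 = 1) 3
    (ExteriorAlgebra.map (Matrix.toLin' (((ε : ℝ) : ℂ) • klSrcAnalysisAtW L'' M β μ Kf J))
      (klEffectiveAction L'' M β U μ Kf klE0 (nScales β + 1))) with hAf_def
  set Ac := srcTrunc ℂ (fun Y : SrcLabel L M J => Y.2 = 1) 3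
    (ExteriorAlgebra.map (Matrix.toLin' (((ε : ℝ) : ℂ) • klSrcAnalysisAtW L M β μ Kc J))
      (klEffectiveAction L M β U μ Kc klE0 (nScales β + 1))) with hAc_def
  set Wf := sectorisedKernel L'' M β (srcWindowFamily L'' M) (klEffectiveAction L'' M β U μ Kf klE0 (nScales β + 1)) 2
    (![((0, 0), 0), ((0, 0), 1)] : Fin 2 → SectorLeg 1) with hWf_def
  set Wc := sectorisedKernel L M β (srcWindowFamily L M) (klEffectiveAction L M β U μ Kc klE0 (nScales β + 1)) 2
    (![((0, 0), 0), ((0, 0), 1)] : Fin 2 → SectorLeg 1) with hWc_def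
  set sP : SectorLeg (sectorCount J) := ((⟨0, sectorCount_pos J⟩, 0), 0) with hsP
  set sM : SectorLeg (sectorCount J) := ((⟨0, sectorCount_pos J⟩, 0), 1) with hsM
  have hMpos : (0 : ℝ) < M := Nat.cast_pos.2 (Nat.pos_of_ne_zero (NeZero.ne M))
  have hε : 0 < ε := by rw [hε_def]; unfold imagTimeWeight; positivity
  -- keyed ↦ e-free
  have hkey : ∀ X : Fin 2 → SrcLabel L'' M J,
      (if ∀ i, (ed (X i)).1 = (ed (X 0)).1 then kernel ℂ Ac 2 (fun i => (ed (X i)).2) else 0) =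
      if ∀ i j, ((X i).1.1.2 j).val / L = ((X 0).1.1.2 j).val / L then
          kernel ℂ Ac 2 (fun i => ((((X i).1.1.1, fun j => ((((X i).1.1.2 j).val : ℕ) : ZMod L)), (X i).1.2), (X i).2))
        else 0 := fun X => keyedReduced_eq_ite e ed he1 he2 hed _ 0 X
  simp only [hkey] at hglued
  -- the e-free summand and the source-pair strings
  let G : (Fin 2 → SrcLabel L'' M J) → ℝ := fun X =>
    ‖kernel ℂ Af 2 X - (if ∀ i j, ((X i).1.1.2 j).val / L = ((X 0).1.1.2 j).val / L then
        kernel ℂ Ac 2 (fun i => ((((X i).1.1.1, fun j => ((((X i).1.1.2 j).val : ℕ) : ZMod L)), (X i).1.2), (X i).2)) else 0)‖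
  let g : ImagTimeIdx M → TorusSite 2 L'' → ℝ := fun t₁ y =>
    ‖Wf ![of, (t₁, y)] - (if ∀ j, (y j).val / L = (of.2 j).val / L then
        Wc ![(of.1, fun i => (((of.2 i).val : ℕ) : ZMod L)), (t₁, fun i => (((y i).val : ℕ) : ZMod L))] else 0)‖
  let ψ : ImagTimeIdx M × TorusSite 2 L'' → (Fin 2 → SrcLabel L'' M J) := fun q => ![((of, sP), 1), (((q.1, q.2), sM), 1)]
  have hG0 : ∀ X, 0 ≤ G X := fun X => norm_nonneg _
  -- termwise: `G (ψ q) = ε² · g q`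
  have hterm : ∀ q : ImagTimeIdx M × TorusSite 2 L'', G (ψ q) = ε ^ 2 * g q.1 q.2 := by
    rintro ⟨t₁, y⟩
    have hf : kernel ℂ Af 2 (ψ (t₁, y)) = ((ε : ℝ) : ℂ) ^ 2 * Wf ![of, (t₁, y)] := by
      rw [hAf_def, hWf_def]
      exact kernel_srcTrunc_map_smul_klSrcAnalysisAtW_pair _ β U μ Kf J (nScales β + 1) of (t₁, y)
    have hres : (fun i => (((((ψ (t₁, y)) i).1.1.1, fun j => (((((ψ (t₁, y)) i).1.1.2 j).val : ℕ) : ZMod L)), ((ψ (t₁, y)) i).1.2),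
        ((ψ (t₁, y)) i).2) : Fin 2 → SrcLabel L M J) =
        ![(((of.1, fun i => (((of.2 i).val : ℕ) : ZMod L)), sP), 1), (((t₁, fun i => (((y i).val : ℕ) : ZMod L)), sM), 1)] := by
      funext i
      fin_cases i <;> rfl
    have hc : kernel ℂ Ac 2 ![(((of.1, fun i => (((of.2 i).val : ℕ) : ZMod L)), sP), 1), (((t₁, fun i => (((y i).val : ℕ) : ZMod L)), sM), 1)] =
        ((ε : ℝ) : ℂ) ^ 2 * Wc ![(of.1, fun i => (((of.2 i).val : ℕ) : ZMod L)), (t₁, fun i => (((y i).val : ℕ) : ZMod L))] := by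
      rw [hAc_def, hWc_def]
      exact kernel_srcTrunc_map_smul_klSrcAnalysisAtW_pair _ β U μ Kc J (nScales β + 1) _ _
    have htest : (∀ i j, (((ψ (t₁, y)) i).1.1.2 j).val / L = (((ψ (t₁, y)) 0).1.1.2 j).val / L) ↔ ∀ j, (y j).val / L = (of.2 j).val / L := by
      constructor
      · intro h j; exact h 1 j
      · intro h i j
        fin_cases i
        · rfl
        · exact h j
    have hnorm : ‖((ε : ℝ) : ℂ) ^ 2‖ = ε ^ 2 := by rw [norm_pow, Complex.norm_real, Real.norm_of_nonneg hε.le]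
    show ‖kernel ℂ Af 2 (ψ (t₁, y)) - _‖ = ε ^ 2 * ‖Wf ![of, (t₁, y)] - _‖
    rw [hf, hres, hc]
    by_cases h : ∀ j, (y j).val / L = (of.2 j).val / L
    · rw [if_pos (htest.2 h), if_pos h, ← mul_sub, norm_mul, hnorm]
    · rw [if_neg (fun h' => h (htest.1 h')), if_neg h, sub_zero, sub_zero, norm_mul, hnorm]
  -- the strings `ψ q` are distinct members of the keyed filter
  have hψinj : Function.Injective ψ := by
    intro q q' h
    have h1 : ((ψ q) 1).1.1 = ((ψ q') 1).1.1 := by rw [h]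
    exact Prod.ext (Prod.mk.inj h1).1 (Prod.mk.inj h1).2
  have hmem : ∀ q, ψ q ∈ univ.filter (fun X : Fin 2 → SrcLabel L'' M J => X 0 = ((of, sP), 1) ∧ (X 1).2 = 1) :=
    fun q => mem_filter.2 ⟨mem_univ _, rfl, rfl⟩
  have hsub : ε ^ 2 * (∑ t₁ : ImagTimeIdx M, ∑ y : TorusSite 2 L'', g t₁ y) ≤
      ∑ X ∈ univ.filter (fun X : Fin 2 → SrcLabel L'' M J => X 0 = ((of, sP), 1) ∧ (X 1).2 = 1), G X := by
    calc ε ^ 2 * (∑ t₁ : ImagTimeIdx M, ∑ y : TorusSite 2 L'', g t₁ y)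
        = ∑ q : ImagTimeIdx M × TorusSite 2 L'', ε ^ 2 * g q.1 q.2 := by
          rw [mul_sum, Fintype.sum_prod_type]
          simp only [mul_sum]
      _ = ∑ q : ImagTimeIdx M × TorusSite 2 L'', G (ψ q) := sum_congr rfl fun q _ => (hterm q).symm
      _ = ∑ X ∈ (univ : Finset (ImagTimeIdx M × TorusSite 2 L'')).image ψ, G X := (sum_image fun q _ q' _ h => hψinj h).symm
      _ ≤ _ := sum_le_sum_of_subset_of_nonneg (fun X hX => by
          obtain ⟨q, -, rfl⟩ := mem_image.1 hX; exact hmem q) fun X _ _ => hG0 X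
  -- assemble: `2ε·GLUED_pos = 2ε⁻¹·(ε²·GLUED_pos) ≤ 2ε⁻¹·KEYED ≤ δ L`
  calc 2 * ε * (∑ t₁ : ImagTimeIdx M, ∑ y : TorusSite 2 L'', g t₁ y)
      = 2 * ε⁻¹ * (ε ^ 2 * ∑ t₁ : ImagTimeIdx M, ∑ y : TorusSite 2 L'', g t₁ y) := two_mul_eps_eq _ _ hε.ne'
    _ ≤ 2 * ε⁻¹ * ∑ X ∈ univ.filter (fun X : Fin 2 → SrcLabel L'' M J => X 0 = ((of, sP), 1) ∧ (X 1).2 = 1), G X :=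
        mul_le_mul_of_nonneg_left hsub (by positivity)
    _ ≤ δ L := hglued

end Summit.HubbardSuperconductivity.HubbardSuperconductivity.Theorems.TwoPointAssembly

end
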